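import Literature.MathematicalPhysics.QuantumFieldTheory.Balaban1983to89.B8Prop3Concrete
import Literature.MathematicalPhysics.QuantumFieldTheory.Balaban1983to89.B9Eq340HolderZd

/-!
# `Balaban1983to89.B8Prop3Holder` — T. Bałaban, *Spaces of regular gauge field configurations on a lattice and gauge
# fixing conditions*, Commun. Math. Phys. **99** (1985) 75–102 [Balaban1985RegularSpaces], **Proposition 3** (p. 87), THE
# HÖLDER MEMBER of (1.62)/(1.36): «‖A‖_{1,β} < 5dLB₀(β)(α₀ + α₁)(Lʲη)^{−2−β}», i.e. the constant «B₂(β₀) = 5dLB₀(β₀)», ON THE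
# CONCRETE `ℤᵈ` CARRIERS (the covariant Hölder seminorm ‖A‖_{1,β} of [4] (3.40) being the sibling `B9Eq340HolderZd.holder1`)

statement-level skeleton of published theorems with citation tags; proofs where landed; nothing here is a claim about the Yang–Mills mass gap

PDF held: `paper:balaban1985-cmp99-regular-spaces-gauge-fixing` (journal page = PDF page + 74); pages read for this module: the
materialised text of pp. 86–87 [PDF 12–13] ((1.55)–(1.62), Proposition 3) and pp. 82–83 [PDF 8–9] ((1.36)–(1.42)); [4] = T. Bałaban,
*Propagators for lattice gauge theories in a background field*, Commun. Math. Phys. **99** (1985) 389–434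
[Balaban1985BackgroundPropagators], p. 397 [PDF 9] READ AS IMAGE (render
`run/shared/lean/pub/pub-balaban/b2b-balaban-ref1/pages/1985-cmp99-background-propagators/…-p009-x2.png`: (3.39)–(3.41));
[3] = [Balaban1985Averaging] only NAMED through the tree modules.

CITATION HEADER (lean-in-tree rule).  Cell `lit-balaban` (HOME `run/shared/lean/pub/lit-balaban/`), unit `lit-balaban-p40`
gen 8 (Phase-2 proof seat p40; B8 fold owner r05, referee ref-4; free-target protocol G.5-34(d), TAKING HOME/STATUS
2026-08-21T18:51:07Z); v1.1 docfix p40 gen 15 (literature-prover-lit-balaban-p40-g15-0): numerals «(1.36) p. 82» / «(1.36)–(1.42) pp. 82–83»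
(print: (1.36)–(1.38) p. 82 [PDF 8], (1.39)–(1.43) p. 83 [PDF 9]; r12 CITELOC §8, r05 QUOTE-AUDIT-B8 §3); declarations unchanged.
WHAT IS REPRODUCED = SKELETON row **`B8.Prop3`** (Proposition 3 p. 87; decl of record `B8.Prop3Printed`
over `fam : I → B8.GFData2`, whose body `B8.Prop3Body` carries the Hölder member as the abstract field `C136 … (5dL·B₀β) …`), the
THIRD CLAUSE of (1.62) = (1.36) «‖A‖_{1,β} < B₂(β₀)(α₀+α₁)(Lʲη)^{−2−β}» for the concrete objects of the tree at one level `j` —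
the item that the seat's own `B8Prop3Concrete` (p259730: the four sup-norm members of (1.62) with `B₁ = 5dLB₀`) records as NOT
MODELLED (its HONEST SCOPE (ii)) and that the cell's interface list records as need I-B8-3 («… the third clause of (1.36) in concrete
Thm 2 / Prop 3», `lit-balaban-r05/INTERFACES-B8.md`).  Kind: kernel-checked theorems only (+ one private arithmetic lemma); no
definition, no `… : Prop` fact; no existing module is modified; 0 sorry.  REUSED BY NAME: the sibling `B9Eq340HolderZd` (the
seminorm `holder1` = ‖A‖_{1,β} of [4] (3.40) on the `ℤᵈ` carriers, `hquot`, `AdmPair`, `trans`, `hquot_le_holder1`, `hquot_le_of_141`),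
`B8Eq155JBound.wsup/jNorm3/gradNorm2/eq155_norm_hermitian`, `B8Eq156Prop4.wsup_B1_le/plaq_le_of_pdev`, `B8.apriori_162`,
`B8Prop3Concrete.prop3_norms_of_small/prop3_pointwise_of_small`, `B7Prop2Explicit.unitaryUnits/avgClosed_unitaryUnits/C0/c2'`,
`B7Prop3Flat.c3`.

WHAT IS PRINTED (verbatim).  B8 p. 86 [PDF 12]: *"Theorem 3.3 of [4] implies the bounds: |A|_(−1), |∇^η_{U₀}A|_(−2),
|D^{η*}_{U₀}D^η_{U₀}A|_(−3), |Δ^η_{U₀}A|_(−3) ≦ B₀(|J|_(−3) + |B₁|) ≦ B₀(2α₀ + 36dα₂|∇^η_{U₀}A|_(−2) + 50dα₂³ + 10dα₀α₂ + 2dLα₁ +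
C₂α₂²). (1.59) Let us take this bound for |∇^η_{U₀}A|_(−2) on the left-hand side, and let us assume that B₀36dα₂ ≦ 1/2. This gives us
a bound for |∇^η_{U₀}A|_(−2), equal to the right-hand side above without this term and multiplied by 2. Using this bound we get …
(1.60) Now we assume further that 2α₂² + 20dα₀α₂ + 2C₂α₂² ≦ α₀ + α₁. (1.61)"*; p. 87 [PDF 13]: *"This and the previous inequality
give finally |A| < 5dLB₀(α₀ + α₁)(Lʲη)⁻¹, |∇^η_{U₀}A| < 5dLB₀(α₀ + α₁)(Lʲη)⁻², ‖A‖_{1,β} < 5dLB₀(β)(α₀ + α₁)(Lʲη)^{−2−β},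
|D^{η*}_{U₀}D^η_{U₀}A|, |Δ^η_{U₀}A| < 5dLB₀(α₀ + α₁)(Lʲη)⁻³ on Ω_j. (1.62)  Let us formulate the results in Proposition 3. If U₀, U₁U₀
satisfy (1.40)–(1.42) with α₀, α₁, α₂ bounded by a constant depending on d and L only, and α₂ satisfies the additional restriction
(1.61), then U₁ satisfies (1.36)–(1.39) with B₁ = 5dLB₀, B₂(β₀) = 5dLB₀(β₀), where B₀, B₀(β₀) are the corresponding norms of the
operators G(U₀), H(U₀), and depend on d and L only, B₀(β₀) on β₀ also."*; p. 82 [PDF 8], (1.36): *"|A| < B₁(α₀ + α₁)(Lʲη)⁻¹,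
|∇^η_{U₀}A| < B₁(α₀ + α₁)(Lʲη)⁻², ‖A‖_{1,β} < B₂(β₀)(α₀ + α₁)(Lʲη)^{−2−β}, β ≦ β₀ < 1, on Ω_j"*; [4] p. 397, (3.40): *"‖A‖_{1,α} =
‖∇A‖_α = max_{μ,ν} sup_{x,x′:|x−x′|≦1} |x′ − x|^{−α}|R(U(Γ_{x,x′}))(D_μA_ν)(x′) − (D_μA_ν)(x)|"*.

DICTIONARY (the `ℤᵈ` model of the parent lineages, as in `B8Prop3Concrete`'s header; only the NEW items are listed).  «‖A‖_{1,β}»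
↦ `B9Eq340HolderZd.holder1 η β len U₀ A` (sibling; transport R(U₀(Γ_{x,x′})) along the staircase, admissible pairs `0 < |x′−x| ≤ 1`
on the η-lattice for a length function `len` — every theorem below holds for EVERY `len`); «on Ω_j» ↦ the lineage's one-level
GLOBAL reading (HONEST SCOPE (i) of `B8Prop3Concrete`): the weighted member `(Lʲη)^{2+β}·‖A‖_{1,β}`.  «B₀(β)» ↦ a real `B₀β ≥ 0`; the
(1.59)-line for the Hölder member — implicit in print («B₀(β₀) … the corresponding norms of the operators G(U₀), H(U₀)», i.e. the
Hölder entries (3.43)–(3.45) of [4] Thm 3.3 applied to (1.58)) — ↦ the displayed hypothesis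
`h59h : (Lʲη)^{2+β}‖A‖_{1,β} ≤ B₀β·(|J|_(−3) + |B₁|)` (`|J|_(−3) = B8Eq155JBound.jNorm3`, `|B₁| = wsup 1 (LʲηQ_jA)` over the bond set
`S` of Λ_j), exactly parallel to `h59a … h59l` of the parents; the bootstrap quantity `|∇^η_{U₀}A|_(−2) = gradNorm2` keeps ITS line
`h59g` (constant `B₀`).

WHAT THIS FILE PROVES (kernel, no `sorry`, axioms ⊆ {propext, Classical.choice, Quot.sound}).  §3 the algebra of pp. 86–87
for a FIFTH (1.59)-type quantity `h ≤ B₀′(|J|_(−3) + |B₁|)` with ITS OWN constant `B₀′`: **`apriori_160_fifth`** ((1.55) + (1.56) +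
the gradient line of (1.59) + «B₀36dα₂ ≦ 1/2» + `50dα₂ ≤ 1` ⇒ `h ≤ B₀′(4α₀ + 4dLα₁ + 2α₂² + 20dα₀α₂ + 2C₂α₂²)`; NO smallness
condition involves `B₀′` — which is exactly why print's `B₂(β₀)` is `5dL·B₀(β₀)` with the SAME factor `5dL` as `B₁ = 5dLB₀`),
`apriori_162_fifth` ((1.61) ⇒ `h ≤ 5dL·B₀′·(α₀ + α₁)`, `B8.apriori_162` BY NAME).  §4 Proposition 3, Hölder clause, concrete:
**`prop3_holder_norm_of_small`** (under the hypotheses of `B8Prop3Concrete.prop3_norms_of_small` — minus the three (1.59)-lines it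
does not need — plus `h59h`: `(Lʲη)^{2+β}‖A‖_{1,β} ≤ 5dL·B₀(β)·(α₀ + α₁)`, for every `len` and every real `β`),
**`prop3_holder_pointwise_of_small`** (AS PRINTED, at every admissible pair and all μ, ν: `|R(U₀(Γ_{x,x′}))(D^η_{U₀,μ}A_ν)(x′) −
(D^η_{U₀,μ}A_ν)(x)| ≤ 5dLB₀(β)(α₀+α₁)·((Lʲη)^{2+β})⁻¹·|x′ − x|^β`, for `0 ≤ β` and a length `≥ 1` on non-zero lattice vectors — e.g.
`l1Len`, `euclidLen` of the sibling), **`prop3_concrete_five`** (Proposition 3 with ALL FIVE members of (1.62) in print's quantifier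
shape: ONE threshold `c(d, L, B₀) > 0` of the same shape as the parent's `prop3_concrete` — `B₀(β)` imposes nothing — giving the four
parent members (norm form and pointwise, BY NAME) and the Hölder member).

HONEST SCOPE.  (i) One level `j`, global reading, exactly as the parent (`B8Prop3Concrete` HONEST SCOPE (i)); «β ≦ β₀ < 1» plays no
rôle in the algebra and is not imposed.  (ii) The (1.59)-Hölder line `h59h` and the gradient line `h59g` are HYPOTHESES in printed
shape (row `B8.Eq1.59`, [4] Thm 3.3 + (1.57)–(1.58); interface need I-B8-2, bounds half); «B₀(β) → ∞ as β → 1» ([4] Thm 3.1) is a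
property of that input, invisible here.  (iii) The sibling's HONEST SCOPE (choice of shortest contour, of the lattice norm `len`)
applies.  (iv) Conclusions are `≤` where print has `<` (as in the tree's (1.60)/(1.62)); (1.61) is taken with the parent's `α₀`-free
`C₂(d) = 2097152(d+1)²`.  Value = the missing fifth member of the row's printed one-page argument on the concrete carriers; NOT summit
progress.
-/

namespace Literature.MathematicalPhysics.QuantumFieldTheory.Balaban1983to89.B8Prop3Holder

-- bare `Site d` must be the `ℤᵈ` carrier `B7Prop1Explicit.Site`, not the torus `Balaban1983to89.Site` of `Setup`
export B7Prop1Explicit (Site)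
open B7Prop1Explicit (U1)
open B7Prop2Explicit (pdev C0 c2' unitaryUnits unitaryUnits_le_U1 C0_pos avgClosed_unitaryUnits)
open B7Prop3Flat (c3)
open B7Prop4GeneralLevels (logCovIter linCovIter)
open B8Lemma1NonAbelian (mulCfg)
open B8Ineq132 (covDiv covDerivFwd plaqF)
open B8Eq146AExpansion (iEta expCfg)
open B8Eq155JBound (wsup wsup_le le_wsup wsup_nonneg jNorm3 gradNorm2 jNorm3_nonneg gradNorm2_nonneg eq155_norm_hermitian)
open B8Eq156Prop4 (plaq_le_of_pdev wsup_B1_le)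
open B8Prop3Concrete (prop3_norms_of_small prop3_pointwise_of_small)
open B9Eq340HolderZd (trans AdmPair hquot holder1 hquot_le_holder1 hquot_le_of_141)

noncomputable section

variable {d : ℕ}

/-! ## §3 The algebra of pp. 86–87 for a fifth (1.59)-type quantity with its own constant -/

/-- **(1.55) + (1.56) + (1.59) ⇒ (1.60) for a FIFTH quantity** (the Hölder member with `B₀(β)`; pure real algebra, kernel twin of
`B8.apriori_160`): from (1.55) `|J|_(−3) ≤ 2α₀ + 36dα₂·g + 50dα₂³ + 10dα₀α₂` (`g = |∇^η_{U₀}A|_(−2)`), (1.56) `|B₁| ≤ 2dLα₁ + C₂α₂²`,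
the gradient line of (1.59) `g ≤ B₀(|J|_(−3) + |B₁|)` (the bootstrap quantity), the printed «B₀36dα₂ ≦ 1/2», `50dα₂ ≤ 1`, and a
line `h ≤ B₀′(|J|_(−3) + |B₁|)` with ANY constant `B₀′ ≥ 0`: `h ≤ B₀′(4α₀ + 4dLα₁ + 2α₂² + 20dα₀α₂ + 2C₂α₂²)` — no smallness
condition involves `B₀′`. [cite: Balaban1985RegularSpaces, (1.55)–(1.60) pp.86–87] -/
theorem apriori_160_fifth {d L C₂ B₀ B₀' α₀ α₁ α₂ nJ nB g h : ℝ}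
    (hd : 0 ≤ d) (hB₀ : 0 ≤ B₀) (hB₀' : 0 ≤ B₀') (hα₀ : 0 ≤ α₀) (hα₂ : 0 ≤ α₂) (hg : 0 ≤ g) (hnB : 0 ≤ nB)
    (h55 : nJ ≤ 2 * α₀ + 36 * d * α₂ * g + 50 * d * α₂ ^ 3 + 10 * d * α₀ * α₂)
    (h56 : nB ≤ 2 * d * L * α₁ + C₂ * α₂ ^ 2)
    (h59g : g ≤ B₀ * (nJ + nB)) (h59h : h ≤ B₀' * (nJ + nB))
    (hside : 36 * d * B₀ * α₂ ≤ 1 / 2) (h50 : 50 * d * α₂ ≤ 1) :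
    h ≤ B₀' * (4 * α₀ + 4 * d * L * α₁ + 2 * α₂ ^ 2 + 20 * d * α₀ * α₂ + 2 * C₂ * α₂ ^ 2) := by
  set Y := 2 * α₀ + 50 * d * α₂ ^ 3 + 10 * d * α₀ * α₂ + nB with hY
  have hdα : 0 ≤ d * α₂ := mul_nonneg hd hα₂
  have hY0 : 0 ≤ Y := by
    rw [hY]; nlinarith [mul_nonneg hdα (sq_nonneg α₂), mul_nonneg hdα hα₀]
  -- (1.59) combined with (1.55): `|J| + |B₁| ≤ Y + 36dα₂·g`
  have hJB : nJ + nB ≤ Y + 36 * d * α₂ * g := by rw [hY]; linarith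
  -- bootstrap for `g` (p. 86): `g ≤ B₀Y + (36dB₀α₂)g ≤ B₀Y + g/2`, hence `g ≤ 2B₀Y`
  have hstep : B₀ * (nJ + nB) ≤ B₀ * Y + 36 * d * B₀ * α₂ * g := by
    have := mul_le_mul_of_nonneg_left hJB hB₀
    linarith [this]
  have hθg : 36 * d * B₀ * α₂ * g ≤ (1 / 2) * g := by
    have := mul_le_mul_of_nonneg_right hside hg
    linarith
  have hg2 : g ≤ 2 * (B₀ * Y) := by linarith
  -- hence `|J| + |B₁| ≤ Y(1 + 72dB₀α₂) ≤ 2Y`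
  have h72 : 36 * d * α₂ * g ≤ Y := by
    have h1 : 36 * d * α₂ * g ≤ 36 * d * α₂ * (2 * (B₀ * Y)) :=
      mul_le_mul_of_nonneg_left hg2 (by positivity)
    have h2 : 36 * d * α₂ * (2 * (B₀ * Y)) = 2 * (36 * d * B₀ * α₂) * Y := by ring
    have h3 : 2 * (36 * d * B₀ * α₂) * Y ≤ 1 * Y := mul_le_mul_of_nonneg_right (by linarith) hY0
    linarith
  have hJB2 : nJ + nB ≤ 2 * Y := by linarith
  -- the fifth line: `h ≤ B₀′(|J| + |B₁|) ≤ 2B₀′Y ≤ B₀′·(printed (1.60) bracket)`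
  have hcube : 100 * d * α₂ ^ 3 ≤ 2 * α₂ ^ 2 := by nlinarith [sq_nonneg α₂, hdα]
  have hfin : 2 * Y ≤ 4 * α₀ + 4 * d * L * α₁ + 2 * α₂ ^ 2 + 20 * d * α₀ * α₂ + 2 * C₂ * α₂ ^ 2 := by
    rw [hY]; linarith
  calc h ≤ B₀' * (nJ + nB) := h59h
    _ ≤ B₀' * (2 * Y) := mul_le_mul_of_nonneg_left hJB2 hB₀'
    _ ≤ B₀' * (4 * α₀ + 4 * d * L * α₁ + 2 * α₂ ^ 2 + 20 * d * α₀ * α₂ + 2 * C₂ * α₂ ^ 2) :=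
        mul_le_mul_of_nonneg_left hfin hB₀'

/-- **(1.60) + (1.61) ⇒ (1.62) for the fifth quantity**: the constant `B₂(β₀) = 5dL·B₀(β₀)` (`B8.apriori_162` BY NAME at `B₀′`).
[cite: Balaban1985RegularSpaces, (1.61)–(1.62) pp.86–87, Prop. 3 p.87] -/
theorem apriori_162_fifth {d L C₂ B₀' α₀ α₁ α₂ h : ℝ} (hB₀' : 0 ≤ B₀') (hdL : 1 ≤ d * L) (hα₀ : 0 ≤ α₀) (hα₁ : 0 ≤ α₁)
    (h61 : 2 * α₂ ^ 2 + 20 * d * α₀ * α₂ + 2 * C₂ * α₂ ^ 2 ≤ α₀ + α₁)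
    (h160 : h ≤ B₀' * (4 * α₀ + 4 * d * L * α₁ + 2 * α₂ ^ 2 + 20 * d * α₀ * α₂ + 2 * C₂ * α₂ ^ 2)) :
    h ≤ 5 * d * L * B₀' * (α₀ + α₁) :=
  h160.trans (B8.apriori_162 hB₀' hdL hα₀ hα₁ h61)

/-! ## §4 Proposition 3, the Hölder member of (1.62), on the concrete `ℤᵈ` carriers -/

section Concrete

variable {𝔸 : Type*} [CStarAlgebra 𝔸] [Nontrivial 𝔸]

/-- From the window `e^{4cα₀}(1 + 8C₁α₂) ≤ 2`: the (1.56)-constant `C₂(d, α₀) = 8C₁e^{4cα₀}` is majorised by the `α₀`-free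
`C₂(d) = 16C₁ = 2097152(d+1)²` (as in the parent's private `C2_le_of_window`). [folklore] -/
private theorem C2_window_le {α₀ α₂ : ℝ} (hα₂ : 0 ≤ α₂)
    (hsmall : Real.exp (4 * (800 * ((d : ℝ) + 1) ^ 2 * ((d : ℝ) + 4)) * α₀)
      * (1 + 8 * (131072 * ((d : ℝ) + 1) ^ 2) * α₂) ≤ 2) :
    8 * (131072 * ((d : ℝ) + 1) ^ 2) * Real.exp (4 * (800 * ((d : ℝ) + 1) ^ 2 * ((d : ℝ) + 4)) * α₀)
      ≤ 2097152 * ((d : ℝ) + 1) ^ 2 := by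
  set E := Real.exp (4 * (800 * ((d : ℝ) + 1) ^ 2 * ((d : ℝ) + 4)) * α₀) with hE
  have hE0 : 0 < E := Real.exp_pos _
  have hy : 0 ≤ 8 * (131072 * ((d : ℝ) + 1) ^ 2) * α₂ := by positivity
  have hE2 : E ≤ 2 := by nlinarith
  have hK : 0 ≤ 8 * (131072 * ((d : ℝ) + 1) ^ 2) := by positivity
  calc 8 * (131072 * ((d : ℝ) + 1) ^ 2) * E ≤ 8 * (131072 * ((d : ℝ) + 1) ^ 2) * 2 :=
        mul_le_mul_of_nonneg_left hE2 hK
    _ = 2097152 * ((d : ℝ) + 1) ^ 2 := by ring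

/-- **(1.40)–(1.42) + (1.61) ⇒ THE HÖLDER MEMBER OF (1.62), NORM FORM** «‖A‖_{1,β} < 5dLB₀(β)(α₀ + α₁)(Lʲη)^{−2−β} on Ω_j» (Sect. C
pp. 86–87 assembled; one level `j`, global reading).  Hypotheses: `U₀` unitary-valued with (1.40) at the level `j` (`h40` plaquettes
= (1.8), `h40₀`/`h40₁` = (1.9) for `U₀` and `U₁U₀`), `A` Hermitian with (1.41) (`h41`), (1.42) second clause on the bond set `S`
of `Λ_j` (`h42`), the displayed smallness of `α₀, α₂` (those of the inputs and «B₀36dα₂ ≦ 1/2», `50dα₂ ≤ 1`, `16α₂ ≤ 1`), the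
restriction (1.61) with `C₂(d) = 2097152(d+1)²` (`h61`), the GRADIENT line of (1.59) (`h59g`, constant `B₀`) and the HÖLDER line
of (1.59) (`h59h`, constant `B₀(β) = B₀β`: `(Lʲη)^{2+β}‖A‖_{1,β} ≤ B₀(β)(|J|_(−3) + |B₁|)`, `|J|_(−3) = jNorm3`, `|B₁| = wsup 1 (LʲηQ_jA)`
over `S`).  Conclusion: `(Lʲη)^{2+β}‖A‖_{1,β} ≤ 5dL·B₀(β)·(α₀ + α₁)`, i.e. `B₂(β) = 5dLB₀(β)` — for EVERY length function `len` and
EVERY real `β`. [cite: Balaban1985RegularSpaces, Prop. 3 (1.62) p.87; (1.59)–(1.61) p.86; (1.36) p.82] -/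
theorem prop3_holder_norm_of_small (hd : 1 ≤ d) {η : ℝ} (hη : 0 < η) {L : ℕ} (hL : 2 ≤ L) {j : ℕ}
    {U₀ : Site d → Fin d → 𝔸ˣ} (hU₀ : ∀ y κ, U₀ y κ ∈ unitaryUnits 𝔸)
    {A : Site d → Fin d → 𝔸} (hAh : ∀ y κ, IsSelfAdjoint (A y κ)) {α₀ α₁ α₂ : ℝ}
    (hα₀ : 0 < α₀) (hα₁ : 0 ≤ α₁) (hα₂ : 0 ≤ α₂)
    (hα3 : C0 d * α₀ ≤ 1 / 3) (hα4 : 4 * α₀ ≤ c2' d L) (h16 : 16 * α₂ ≤ 1)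
    (hsmall : Real.exp (4 * (800 * ((d : ℝ) + 1) ^ 2 * ((d : ℝ) + 4)) * α₀)
      * (1 + 8 * (131072 * ((d : ℝ) + 1) ^ 2) * α₂) ≤ 2)
    (hc₃ : 2 * α₂ ≤ c3 d L) {B₀ : ℝ} (hB₀ : 0 ≤ B₀) (hside : 36 * d * B₀ * α₂ ≤ 1 / 2) (h50 : 50 * d * α₂ ≤ 1)
    (h61 : 2 * α₂ ^ 2 + 20 * d * α₀ * α₂ + 2 * (2097152 * ((d : ℝ) + 1) ^ 2) * α₂ ^ 2 ≤ α₀ + α₁)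
    (h40 : pdev U₀ < α₀ * (((L : ℝ) ^ j)⁻¹) ^ 2)
    (h40₀ : ∀ (μ : Fin d) (x : Site d), ‖covDiv η U₀ μ x‖ ≤ α₀ * η ^ 2 * (((L : ℝ) ^ j * η)⁻¹) ^ 3)
    (h40₁ : ∀ (μ : Fin d) (x : Site d),
      ‖covDiv η (mulCfg (expCfg (iEta η A)) U₀) μ x‖ ≤ α₀ * η ^ 2 * (((L : ℝ) ^ j * η)⁻¹) ^ 3)
    (h41 : ∀ y κ, ‖A y κ‖ ≤ α₂ * ((L : ℝ) ^ j * η)⁻¹)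
    (S : Set (Site d × Fin d)) (h42 : ∀ b ∈ S, ‖logCovIter L U₀ (iEta η A) j b.1 b.2‖ < 2 * d * L * α₁)
    (h59g : gradNorm2 η L j U₀ A
      ≤ B₀ * (jNorm3 η L j U₀ A + wsup 1 (fun b : S => linCovIter L U₀ (iEta η A) j b.1.1 b.1.2)))
    {β B₀β : ℝ} (hB₀β : 0 ≤ B₀β) (len : Site d → ℝ)
    (h59h : ((L : ℝ) ^ j * η) ^ (2 + β) * holder1 η β len U₀ A
      ≤ B₀β * (jNorm3 η L j U₀ A + wsup 1 (fun b : S => linCovIter L U₀ (iEta η A) j b.1.1 b.1.2))) :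
    ((L : ℝ) ^ j * η) ^ (2 + β) * holder1 η β len U₀ A ≤ 5 * d * L * B₀β * (α₀ + α₁) := by
  have hd' : (1 : ℝ) ≤ d := by exact_mod_cast hd
  have hL0 : 0 < L := lt_of_lt_of_le (by norm_num) hL
  have hL1 : (1 : ℝ) ≤ L := by exact_mod_cast (le_trans (by norm_num) hL)
  have hLj : (1 : ℝ) ≤ (L : ℝ) ^ j := one_le_pow₀ hL1
  have h₀ : ∀ y κ, U₀ y κ ∈ U1 𝔸 := fun y κ => unitaryUnits_le_U1 (hU₀ y κ)
  -- `α₂(Lʲη)⁻¹η = α₂/Lʲ ≤ α₂`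
  have hresc : α₂ * ((L : ℝ) ^ j * η)⁻¹ * η = α₂ * ((L : ℝ) ^ j)⁻¹ := by
    field_simp
  have hle : α₂ * ((L : ℝ) ^ j * η)⁻¹ * η ≤ α₂ := by
    rw [hresc]
    have : ((L : ℝ) ^ j)⁻¹ ≤ 1 := inv_le_one_of_one_le₀ hLj
    calc α₂ * ((L : ℝ) ^ j)⁻¹ ≤ α₂ * 1 := mul_le_mul_of_nonneg_left this hα₂
      _ = α₂ := mul_one _
  have hsmall16 : 16 * (α₂ * ((L : ℝ) ^ j * η)⁻¹ * η) ≤ 1 := by linarith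
  have hd1 : (0 : ℝ) ≤ (d : ℝ) - 1 := by linarith
  have hd5 : 5 * (α₂ * ((L : ℝ) ^ j * η)⁻¹ * η) * ((d : ℝ) - 1) ≤ 4 := by
    have h1 := mul_le_mul_of_nonneg_right (mul_le_mul_of_nonneg_left hle (by norm_num : (0 : ℝ) ≤ 5)) hd1
    have h2 : 5 * α₂ * ((d : ℝ) - 1) ≤ 4 := by nlinarith
    linarith
  -- (1.55) for Hermitian `A`, (1.56) on `S`
  have hp : ∀ (y : Site d) (κ ν : Fin d), κ ≠ ν → ‖plaqF U₀ κ ν y - 1‖ ≤ α₀ * η ^ 2 * (((L : ℝ) ^ j * η)⁻¹) ^ 2 :=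
    fun y κ ν _ => plaq_le_of_pdev hη hL0 h₀ h40 y κ ν
  have h55 := eq155_norm_hermitian hη h₀ hAh hL0 hα₀.le hα₂ h41 hp hsmall16 hd5 h40₁ h40₀
  have h56 := wsup_B1_le hη L hL (avgClosed_unitaryUnits d L) j U₀ hU₀ hα₀ hα3 hα4 h40 A hα₂ h41 hsmall hc₃ hα₁
    (Subtype.val : S → Site d × Fin d) (fun b => h42 b.1 b.2)
  -- the fifth-quantity algebra with `C₂(d, α₀)`, then `C₂(d, α₀) ≤ C₂(d)`, then (1.61) ⇒ (1.62)
  have h160 := apriori_160_fifth (Nat.cast_nonneg d) hB₀ hB₀β hα₀.le hα₂ (gradNorm2_nonneg η L j U₀ A)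
    (wsup_nonneg zero_le_one _) h55 h56 h59g h59h hside h50
  have hC := C2_window_le (d := d) hα₂ hsmall
  have h160' : ((L : ℝ) ^ j * η) ^ (2 + β) * holder1 η β len U₀ A ≤ B₀β * (4 * α₀ + 4 * d * L * α₁ + 2 * α₂ ^ 2
      + 20 * d * α₀ * α₂ + 2 * (2097152 * ((d : ℝ) + 1) ^ 2) * α₂ ^ 2) := by
    refine h160.trans (mul_le_mul_of_nonneg_left ?_ hB₀β)
    have hsq : 0 ≤ α₂ ^ 2 := sq_nonneg _
    nlinarith [mul_le_mul_of_nonneg_right hC hsq]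
  have hdL : (1 : ℝ) ≤ (d : ℝ) * L := by nlinarith
  exact apriori_162_fifth hB₀β hdL hα₀.le hα₁ h61 h160'

/-- **THE HÖLDER MEMBER OF (1.62) AS PRINTED, POINTWISE** «‖A‖_{1,β} < 5dLB₀(β)(α₀ + α₁)(Lʲη)^{−2−β} on Ω_j»: under the
hypotheses of `prop3_holder_norm_of_small`, `0 ≤ β` and a length `≥ 1` on the admissible displacements (`l1Len`, `euclidLen`),
at EVERY pair `x, x′` with `0 < |x′ − x| ≤ 1` and all `μ, ν`:
`|R(U₀(Γ_{x,x′}))(D^η_{U₀,μ}A_ν)(x′) − (D^η_{U₀,μ}A_ν)(x)| ≤ 5dLB₀(β)(α₀ + α₁)·((Lʲη)^{2+β})⁻¹·|x′ − x|^β`.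
[cite: Balaban1985RegularSpaces, Prop. 3 (1.62) p.87, (1.36) p.82; Balaban1985BackgroundPropagators, (3.40) p.397] -/
theorem prop3_holder_pointwise_of_small (hd : 1 ≤ d) {η : ℝ} (hη : 0 < η) {L : ℕ} (hL : 2 ≤ L) {j : ℕ}
    {U₀ : Site d → Fin d → 𝔸ˣ} (hU₀ : ∀ y κ, U₀ y κ ∈ unitaryUnits 𝔸)
    {A : Site d → Fin d → 𝔸} (hAh : ∀ y κ, IsSelfAdjoint (A y κ)) {α₀ α₁ α₂ : ℝ}
    (hα₀ : 0 < α₀) (hα₁ : 0 ≤ α₁) (hα₂ : 0 ≤ α₂)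
    (hα3 : C0 d * α₀ ≤ 1 / 3) (hα4 : 4 * α₀ ≤ c2' d L) (h16 : 16 * α₂ ≤ 1)
    (hsmall : Real.exp (4 * (800 * ((d : ℝ) + 1) ^ 2 * ((d : ℝ) + 4)) * α₀)
      * (1 + 8 * (131072 * ((d : ℝ) + 1) ^ 2) * α₂) ≤ 2)
    (hc₃ : 2 * α₂ ≤ c3 d L) {B₀ : ℝ} (hB₀ : 0 ≤ B₀) (hside : 36 * d * B₀ * α₂ ≤ 1 / 2) (h50 : 50 * d * α₂ ≤ 1)
    (h61 : 2 * α₂ ^ 2 + 20 * d * α₀ * α₂ + 2 * (2097152 * ((d : ℝ) + 1) ^ 2) * α₂ ^ 2 ≤ α₀ + α₁)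
    (h40 : pdev U₀ < α₀ * (((L : ℝ) ^ j)⁻¹) ^ 2)
    (h40₀ : ∀ (μ : Fin d) (x : Site d), ‖covDiv η U₀ μ x‖ ≤ α₀ * η ^ 2 * (((L : ℝ) ^ j * η)⁻¹) ^ 3)
    (h40₁ : ∀ (μ : Fin d) (x : Site d),
      ‖covDiv η (mulCfg (expCfg (iEta η A)) U₀) μ x‖ ≤ α₀ * η ^ 2 * (((L : ℝ) ^ j * η)⁻¹) ^ 3)
    (h41 : ∀ y κ, ‖A y κ‖ ≤ α₂ * ((L : ℝ) ^ j * η)⁻¹)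
    (S : Set (Site d × Fin d)) (h42 : ∀ b ∈ S, ‖logCovIter L U₀ (iEta η A) j b.1 b.2‖ < 2 * d * L * α₁)
    (h59g : gradNorm2 η L j U₀ A
      ≤ B₀ * (jNorm3 η L j U₀ A + wsup 1 (fun b : S => linCovIter L U₀ (iEta η A) j b.1.1 b.1.2)))
    {β B₀β : ℝ} (hβ : 0 ≤ β) (hB₀β : 0 ≤ B₀β) {len : Site d → ℝ} (hlen : ∀ v : Site d, 0 < len v → 1 ≤ len v)
    (h59h : ((L : ℝ) ^ j * η) ^ (2 + β) * holder1 η β len U₀ A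
      ≤ B₀β * (jNorm3 η L j U₀ A + wsup 1 (fun b : S => linCovIter L U₀ (iEta η A) j b.1.1 b.1.2)))
    (μ ν : Fin d) {p : Site d × Site d} (hp : p ∈ AdmPair η len) :
    ‖trans U₀ p.1 p.2 (covDerivFwd η U₀ μ (fun z => A z ν) p.2) - covDerivFwd η U₀ μ (fun z => A z ν) p.1‖
      ≤ 5 * d * L * B₀β * (α₀ + α₁) * ((((L : ℝ) ^ j * η) ^ (2 + β))⁻¹) * (η * len (p.2 - p.1)) ^ β := by
  have hN := prop3_holder_norm_of_small hd hη hL hU₀ hAh hα₀ hα₁ hα₂ hα3 hα4 h16 hsmall hc₃ hB₀ hside h50 h61 h40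
    h40₀ h40₁ h41 S h42 h59g hB₀β len h59h
  have hL0 : 0 < L := lt_of_lt_of_le (by norm_num) hL
  have h₀ : ∀ y κ, U₀ y κ ∈ U1 𝔸 := fun y κ => unitaryUnits_le_U1 (hU₀ y κ)
  set s : ℝ := (L : ℝ) ^ j * η with hs
  have hs0 : 0 < s := by positivity
  have hsβ : 0 < s ^ (2 + β) := Real.rpow_pos_of_pos hs0 _
  -- every quotient is below `‖A‖_{1,β}` (bounded family under (1.41)), hence below `C·(s^{2+β})⁻¹`
  have hq : hquot η β len U₀ (covDerivFwd η U₀ μ (fun z => A z ν)) p ≤ holder1 η β len U₀ A :=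
    hquot_le_holder1 (fun μ' ν' p' hp' => hquot_le_of_141 hη hβ hlen hL0 j h₀ h41 μ' ν' hp') μ ν hp
  have hq' : hquot η β len U₀ (covDerivFwd η U₀ μ (fun z => A z ν)) p
      ≤ 5 * d * L * B₀β * (α₀ + α₁) * (s ^ (2 + β))⁻¹ := by
    rw [← div_eq_mul_inv, le_div_iff₀ hsβ, mul_comm]
    exact (mul_le_mul_of_nonneg_left hq hsβ.le).trans hN
  have hD : 0 < (η * len (p.2 - p.1)) ^ β := Real.rpow_pos_of_pos (mul_pos hη hp.1) β
  unfold hquot at hq'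
  rwa [div_le_iff₀ hD] at hq'

/-- **PROPOSITION 3 (p. 87) ON THE `ℤᵈ` CARRIERS WITH ALL FIVE MEMBERS OF (1.62)**, one level `j`: «α₀, α₁, α₂ bounded by a
constant depending on d and L only» made explicit as `c = c(d, L, B₀) > 0` (the SAME shape as the parent's `prop3_concrete`; `B₀(β)`
imposes no smallness), namely `c = min{1/(24C₀(d)), c₂′(d,L)/16, 1/(32000(d+1)²(d+4)), 1/(2097152(d+1)²), c₃(d,L)/2, 1/(80d),
1/(72d(B₀+1))}`; for all `0 < α₀, α₁, α₂ ≤ c` with (1.61) (`C₂ = C₂(d)`), every unitary-valued `U₀` and Hermitian `A` satisfying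
(1.40)–(1.42) at the level `j`, the four (1.59) bounds of Theorem 3.3 of [4] AND its Hölder line with constant `B₀(β) ≥ 0`, the
configuration `U₁ = e^{iηA}` satisfies (1.62) = (1.36)/(1.39) with `B₁ = 5dLB₀` (the parent's four members, norm form and
pointwise, BY NAME) and `B₂(β) = 5dLB₀(β)`: `(Lʲη)^{2+β}‖A‖_{1,β} ≤ 5dLB₀(β)(α₀+α₁)`.
[cite: Balaban1985RegularSpaces, Prop. 3 p.87; (1.36)–(1.42) pp.82–83; (1.59)–(1.62) pp.86–87] -/
theorem prop3_concrete_five (hd : 1 ≤ d) {η : ℝ} (hη : 0 < η) {L : ℕ} (hL : 2 ≤ L) (j : ℕ) {B₀ : ℝ} (hB₀ : 0 ≤ B₀) :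
    ∃ c : ℝ, 0 < c ∧ ∀ ⦃α₀ α₁ α₂ : ℝ⦄, 0 < α₀ → α₀ ≤ c → 0 < α₁ → α₁ ≤ c → 0 < α₂ → α₂ ≤ c →
      2 * α₂ ^ 2 + 20 * d * α₀ * α₂ + 2 * (2097152 * ((d : ℝ) + 1) ^ 2) * α₂ ^ 2 ≤ α₀ + α₁ →
      ∀ (U₀ : Site d → Fin d → 𝔸ˣ), (∀ y κ, U₀ y κ ∈ unitaryUnits 𝔸) →
      ∀ (A : Site d → Fin d → 𝔸), (∀ y κ, IsSelfAdjoint (A y κ)) →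
      pdev U₀ < α₀ * (((L : ℝ) ^ j)⁻¹) ^ 2 →
      (∀ (μ : Fin d) (x : Site d), ‖covDiv η U₀ μ x‖ ≤ α₀ * η ^ 2 * (((L : ℝ) ^ j * η)⁻¹) ^ 3) →
      (∀ (μ : Fin d) (x : Site d),
        ‖covDiv η (mulCfg (expCfg (iEta η A)) U₀) μ x‖ ≤ α₀ * η ^ 2 * (((L : ℝ) ^ j * η)⁻¹) ^ 3) →
      (∀ y κ, ‖A y κ‖ ≤ α₂ * ((L : ℝ) ^ j * η)⁻¹) →
      ∀ (S : Set (Site d × Fin d)), (∀ b ∈ S, ‖logCovIter L U₀ (iEta η A) j b.1 b.2‖ < 2 * d * L * α₁) →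
      ∀ ⦃j₂ l : ℝ⦄,
      wsup ((L : ℝ) ^ j * η) (fun p : Site d × Fin d => A p.1 p.2)
        ≤ B₀ * (jNorm3 η L j U₀ A + wsup 1 (fun b : S => linCovIter L U₀ (iEta η A) j b.1.1 b.1.2)) →
      gradNorm2 η L j U₀ A
        ≤ B₀ * (jNorm3 η L j U₀ A + wsup 1 (fun b : S => linCovIter L U₀ (iEta η A) j b.1.1 b.1.2)) →
      j₂ ≤ B₀ * (jNorm3 η L j U₀ A + wsup 1 (fun b : S => linCovIter L U₀ (iEta η A) j b.1.1 b.1.2)) →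
      l ≤ B₀ * (jNorm3 η L j U₀ A + wsup 1 (fun b : S => linCovIter L U₀ (iEta η A) j b.1.1 b.1.2)) →
      ∀ ⦃β B₀β : ℝ⦄, 0 ≤ B₀β → ∀ (len : Site d → ℝ),
      ((L : ℝ) ^ j * η) ^ (2 + β) * holder1 η β len U₀ A
        ≤ B₀β * (jNorm3 η L j U₀ A + wsup 1 (fun b : S => linCovIter L U₀ (iEta η A) j b.1.1 b.1.2)) →
      (wsup ((L : ℝ) ^ j * η) (fun p : Site d × Fin d => A p.1 p.2) ≤ 5 * d * L * B₀ * (α₀ + α₁) ∧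
        gradNorm2 η L j U₀ A ≤ 5 * d * L * B₀ * (α₀ + α₁) ∧
        j₂ ≤ 5 * d * L * B₀ * (α₀ + α₁) ∧ l ≤ 5 * d * L * B₀ * (α₀ + α₁)) ∧
      (∀ y κ, ‖A y κ‖ ≤ 5 * d * L * B₀ * (α₀ + α₁) * ((L : ℝ) ^ j * η)⁻¹) ∧
      (∀ (y : Site d) (κ τ : Fin d),
        ‖covDerivFwd η U₀ κ (fun z => A z τ) y‖ ≤ 5 * d * L * B₀ * (α₀ + α₁) * (((L : ℝ) ^ j * η)⁻¹) ^ 2) ∧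
      ((L : ℝ) ^ j * η) ^ (2 + β) * holder1 η β len U₀ A ≤ 5 * d * L * B₀β * (α₀ + α₁) := by
  have hd' : (1 : ℝ) ≤ d := by exact_mod_cast hd
  have hd0 : (0 : ℝ) < d := by linarith
  have hL1 : 1 ≤ L := le_trans (by norm_num) hL
  have hC0 := C0_pos d
  have hc2 : 0 < c2' d L := B7Prop2Explicit.c2'_pos d L hL1
  have hc3 : 0 < c3 d L := B7Prop3Flat.c3_pos d hL1
  refine ⟨min (1 / (24 * C0 d)) (min (c2' d L / 16) (min (1 / (32000 * ((d : ℝ) + 1) ^ 2 * ((d : ℝ) + 4)))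
    (min (1 / (2097152 * ((d : ℝ) + 1) ^ 2)) (min (c3 d L / 2) (min (1 / (80 * (d : ℝ)))
    (1 / (72 * (d : ℝ) * (B₀ + 1)))))))), ?_, ?_⟩
  · refine lt_min (by positivity) (lt_min (by positivity) (lt_min (by positivity) (lt_min (by positivity)
      (lt_min (by positivity) (lt_min (by positivity) (by positivity))))))
  intro α₀ α₁ α₂ hα₀ hα₀c hα₁ hα₁c hα₂ hα₂c h61 U₀ hU₀ A hAh h40 h40₀ h40₁ h41 S h42 j₂ l h59a h59g h59j h59l β B₀β hB₀β
    len h59h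
  simp only [le_min_iff] at hα₀c hα₂c
  obtain ⟨h24₀, h16₀, h32₀, -, -, -, -⟩ := hα₀c
  obtain ⟨-, -, -, h21₂, hc3₂, h80₂, h72₂⟩ := hα₂c
  -- the windows (as in the parent's `prop3_concrete`)
  have hα3 : C0 d * α₀ ≤ 1 / 3 := by
    have e : C0 d * (1 / (24 * C0 d)) = 1 / 24 := by field_simp
    have := (mul_le_mul_of_nonneg_left h24₀ hC0.le).trans_eq e
    linarith
  have hα4 : 4 * α₀ ≤ c2' d L := by linarith
  have h80 : α₂ ≤ 1 / 80 := by
    have : (1 : ℝ) / (80 * d) ≤ 1 / 80 := by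
      rw [div_le_div_iff₀ (by positivity) (by norm_num)]; nlinarith
    exact h80₂.trans this
  have h16 : 16 * α₂ ≤ 1 := by linarith
  have hdα : (d : ℝ) * α₂ ≤ 1 / 80 := by
    have := mul_le_mul_of_nonneg_left h80₂ hd0.le
    have e : (d : ℝ) * (1 / (80 * d)) = 1 / 80 := by field_simp
    linarith [this.trans_eq e]
  have h50 : 50 * d * α₂ ≤ 1 := by nlinarith
  have hside : 36 * d * B₀ * α₂ ≤ 1 / 2 := by
    have h1 : 36 * d * B₀ * α₂ ≤ 36 * d * B₀ * (1 / (72 * (d : ℝ) * (B₀ + 1))) :=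
      mul_le_mul_of_nonneg_left h72₂ (by positivity)
    have e : 36 * d * B₀ * (1 / (72 * (d : ℝ) * (B₀ + 1))) = B₀ / (2 * (B₀ + 1)) := by
      field_simp
      ring
    have h2 : B₀ / (2 * (B₀ + 1)) ≤ 1 / 2 := by
      rw [div_le_div_iff₀ (by positivity) (by norm_num)]; nlinarith
    linarith [h1.trans_eq e]
  have hsmall : Real.exp (4 * (800 * ((d : ℝ) + 1) ^ 2 * ((d : ℝ) + 4)) * α₀)
      * (1 + 8 * (131072 * ((d : ℝ) + 1) ^ 2) * α₂) ≤ 2 := by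
    have hx0 : 0 ≤ 4 * (800 * ((d : ℝ) + 1) ^ 2 * ((d : ℝ) + 4)) * α₀ := by positivity
    have hx : 4 * (800 * ((d : ℝ) + 1) ^ 2 * ((d : ℝ) + 4)) * α₀ ≤ 1 / 10 := by
      have h := mul_le_mul_of_nonneg_left h32₀ (by positivity : (0 : ℝ) ≤ 3200 * (((d : ℝ) + 1) ^ 2 * ((d : ℝ) + 4)))
      have e : (3200 * (((d : ℝ) + 1) ^ 2 * ((d : ℝ) + 4))) * (1 / (32000 * ((d : ℝ) + 1) ^ 2 * ((d : ℝ) + 4)))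
          = 1 / 10 := by
        field_simp; ring
      have e' : 4 * (800 * ((d : ℝ) + 1) ^ 2 * ((d : ℝ) + 4)) * α₀
          = (3200 * (((d : ℝ) + 1) ^ 2 * ((d : ℝ) + 4))) * α₀ := by ring
      rw [e']; exact h.trans_eq e
    have hy0 : 0 ≤ 8 * (131072 * ((d : ℝ) + 1) ^ 2) * α₂ := by positivity
    have hy : 8 * (131072 * ((d : ℝ) + 1) ^ 2) * α₂ ≤ 1 / 2 := by
      have h := mul_le_mul_of_nonneg_left h21₂ (by positivity : (0 : ℝ) ≤ 1048576 * ((d : ℝ) + 1) ^ 2)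
      have e : (1048576 * ((d : ℝ) + 1) ^ 2) * (1 / (2097152 * ((d : ℝ) + 1) ^ 2)) = 1 / 2 := by
        field_simp; ring
      have e' : 8 * (131072 * ((d : ℝ) + 1) ^ 2) * α₂ = (1048576 * ((d : ℝ) + 1) ^ 2) * α₂ := by ring
      rw [e']; exact h.trans_eq e
    -- `e^{x}(1 + y) ≤ 2` for `x ≤ 1/10`, `y ≤ 1/2`
    have hexp := Real.abs_exp_sub_one_le (x := 4 * (800 * ((d : ℝ) + 1) ^ 2 * ((d : ℝ) + 4)) * α₀)
      (by rw [abs_of_nonneg hx0]; linarith)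
    rw [abs_of_nonneg hx0] at hexp
    have h2 : Real.exp (4 * (800 * ((d : ℝ) + 1) ^ 2 * ((d : ℝ) + 4)) * α₀) ≤ 6 / 5 := by
      linarith [(abs_le.mp hexp).2]
    calc Real.exp (4 * (800 * ((d : ℝ) + 1) ^ 2 * ((d : ℝ) + 4)) * α₀) * (1 + 8 * (131072 * ((d : ℝ) + 1) ^ 2) * α₂)
        ≤ 6 / 5 * (1 + 1 / 2) := by gcongr
      _ ≤ 2 := by norm_num
  have hc₃ : 2 * α₂ ≤ c3 d L := by linarith
  have hN := prop3_norms_of_small hd hη hL hU₀ hAh hα₀ hα₁.le hα₂.le hα3 hα4 h16 hsmall hc₃ hB₀ hside h50 h61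
    h40 h40₀ h40₁ h41 S h42 h59a h59g h59j h59l
  obtain ⟨hP1, hP2, -, -⟩ := prop3_pointwise_of_small hd hη hL hU₀ hAh hα₀ hα₁.le hα₂.le hα3 hα4 h16 hsmall hc₃
    hB₀ hside h50 h61 h40 h40₀ h40₁ h41 S h42 h59a h59g h59j h59l
  have hH := prop3_holder_norm_of_small hd hη hL hU₀ hAh hα₀ hα₁.le hα₂.le hα3 hα4 h16 hsmall hc₃ hB₀ hside h50 h61
    h40 h40₀ h40₁ h41 S h42 h59g hB₀β len h59h
  exact ⟨hN, hP1, hP2, hH⟩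

end Concrete

end

end Literature.MathematicalPhysics.QuantumFieldTheory.Balaban1983to89.B8Prop3Holder
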